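import Literature.Barriers.Parity.SiegelZeroPrimePairsEq71Weak
import Literature.Barriers.Parity.SiegelZeroPrimePairsWeakThirdRateSmallShift
import HarnessLib

/-!
# Matomäki–Merikoski, Corollary 1.1(i) from the ADMISSIBLE MAIN TERM of §7 alone

Sibling of `SiegelZeroPrimePairsEq71Weak.lean` ((7.1) in weak currency: the passage from
`∑ g(n/x)Λ(n)Λ(n+h)` to `∑_{adm} g(n/x)λ'(n)λ'(n+h)`) and `SiegelZeroPrimePairsWeakThirdRateSmallShift.lean`
(Corollary 1.1(i) from the core smoothed bound for shifts `h ≤ A` with the third rate `V η^{κ−1}`).  Everything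
here is PROVED (theorems only; no definition, no named fact).  Composing the two, Corollary 1.1(i) of
Matomäki–Merikoski (IMRN 2023; arXiv:2112.11412; `Literature.Barriers.Parity.MatomakiMerikoski2023_fixedShift`)
is reduced to the **asymptotic for the admissible main term** alone — the content of Proposition 2.3, Lemmas 2.4
(classical form, tree: `MatomakiMerikoski2023_lemma24_classical`) and 2.5 (tree: `MatomakiMerikoski2023_charSum_*`)
and of the main-term computation of §7 (pp. 20–21 of the source):

* `MatomakiMerikoski.MatomakiMerikoski2023_fixedShift_of_admMainTerm` — if for every `C ≥ 1`, `A > 0` there are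
  `η₀, K` such that for every primitive quadratic `χ (mod q)`, `q ≥ 3`, `η ≥ max(10, η₀)` with
  `log η ≤ (log q)/100` and `L(1 − 1/(η log q), χ) = 0`, every `x ≥ max(q^{37/4}, A)` with `V η^{−1/4} ≤ 1`
  (`V = log x/log q`, `ℓ = log η`, `u = min{√(Vℓ)/(10C), ℓ}`, `v = V/u`), every
  `x^{−1/999}/4 ≤ δ ≤ min(x^{−1/1000}, 1/2)` and every EVEN `1 ≤ h ≤ A`,
  `|∑_{n ≤ 2x, adm} g_δ(n/x) λ'(n)λ'(n+h) − x (∫ g_δ) 𝔖_h (1 + corr_q(h))| ≤ K (h/φ(h)) x (e^{−C√(Vℓ)} + e^{−c₀√log x} + V η^{−1/4})`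
  (`g_δ = plateauCutoff (1+δ) (2−δ) δ`, "adm" = all prime factors of `n` and `n + h` are `≥ q^v` and prime to
  `q`, `corr` the correction factor of Theorem 1.3), for some fixed `c₀ > 0`, then
  `MatomakiMerikoski2023_fixedShift` holds (**proved**).

The two normalisations granted to the main-term statement are discharged here: `log η ≤ (log q)/100` and
`x ≥ A` both follow from Siegel's theorem (`Siegel.exists_one_sub_realZero_ge` at `ε = 1/200`: `η ≤ D q^{1/200}`)
after enlarging `η₀` (if `q^{1/200} < D` or `x < A` then `η < D(D + 1 + A)`), exactly as "we can clearly assume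
that `η` is large" in §7 of the source.

## References

* K. Matomäki, J. Merikoski, IMRN 2023:23, 20337–20384 (arXiv:2112.11412), §7 (pp. 20–21), (7.1)–(7.2),
  Corollary 1.1(i). [cite: MatomakiMerikoski2023, §7 and Corollary 1.1(i)]
* H. L. Montgomery, R. C. Vaughan, *Multiplicative Number Theory I*, Cambridge 2007, Cor. 11.15 (Siegel).
  [cite: MontgomeryVaughan2007, Corollary 11.15]
-/

noncomputable section

open Finset Real
open scoped ArithmeticFunction.vonMangoldt

namespace Literature.Barriers.Parity.MatomakiMerikoski

open Literature.Barriers.Parity.TaoTeravainen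
open Literature.NumberTheory.Sieve (goldbachSingularSeries plateauCutoff plateauCutoff_nonneg plateauCutoff_le_one
  plateauCutoff_eq_zero_of_le plateauCutoff_eq_zero_of_ge)

set_option maxHeartbeats 1600000 in
/-- **Corollary 1.1(i) from the admissible main term.**  See the module docstring for the statement of the
hypothesis `HMT` (the main-term asymptotic of §7 for `∑_{adm} g(n/x)λ'(n)λ'(n+h)`, classical second rate, third
rate `V η^{−1/4}`, even shifts `h ≤ A`, `η` large, `log η ≤ (log q)/100`, `x ≥ A`).  Proof: Siegel's theorem
disposes of the two normalisations; `MatomakiMerikoski2023_eq71_weak` ((7.1), weak form) and `HMT` give the core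
smoothed bound of `MatomakiMerikoski2023_fixedShift_of_core_smallShift_rpow` at `κ = 3/4`.
[cite: MatomakiMerikoski2023, §7 and Corollary 1.1(i)] -/
theorem MatomakiMerikoski2023_fixedShift_of_admMainTerm {c₀ : ℝ} (hc₀ : 0 < c₀)
    (HMT : ∀ C : ℝ, 1 ≤ C → ∀ A : ℝ, 0 < A → ∃ η₀ K : ℝ, 0 < K ∧
      ∀ (q : ℕ) [NeZero q], 3 ≤ q → ∀ χ : DirichletCharacter ℂ q, χ.IsPrimitive → χ.IsQuadratic →
        ∀ η : ℝ, 10 ≤ η → η₀ ≤ η → Real.log η ≤ Real.log q / 100 →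
          χ.LFunction ((1 - 1 / (η * Real.log q) : ℝ) : ℂ) = 0 →
          ∀ x : ℝ, (q : ℝ) ^ (37 / 4 : ℝ) ≤ x → A ≤ x → Real.log x / Real.log q * η ^ (-(1 / 4 : ℝ)) ≤ 1 →
            ∀ V ℓ u v : ℝ, V = Real.log x / Real.log q → ℓ = Real.log η →
              u = min (Real.sqrt (V * ℓ) / (10 * C)) ℓ → v = V / u →
            ∀ δ : ℝ, x ^ (-(1 / 999 : ℝ)) / 4 ≤ δ → δ ≤ x ^ (-(1 / 1000 : ℝ)) → δ ≤ 1 / 2 →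
            ∀ h : ℕ, 1 ≤ h → Even h → (h : ℝ) ≤ A →
              |(∑ n ∈ (Icc 1 ⌊2 * x⌋₊).filter (fun n : ℕ =>
                    (∀ p ∈ n.primeFactors, (q : ℝ) ^ v ≤ (p : ℝ) ∧ ¬ p ∣ q) ∧
                      (∀ p ∈ (n + h).primeFactors, (q : ℝ) ^ v ≤ (p : ℝ) ∧ ¬ p ∣ q)),
                  plateauCutoff (1 + δ) (2 - δ) δ (n / x) * charLog χ n * charLog χ (n + h)) -
                  x * (∫ u, plateauCutoff (1 + δ) (2 - δ) δ u) * goldbachSingularSeries h *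
                    (1 + if Nat.totient (2 ^ padicValNat 2 q) ∣ h then
                          (-1 : ℝ) ^ (h / Nat.totient (2 ^ padicValNat 2 q)) *
                            ∏ p ∈ (q / 2 ^ padicValNat 2 q).primeFactors.filter (fun p => ¬ p ∣ h),
                              (-1 : ℝ) / ((p : ℝ) - 2)
                        else 0)| ≤
                K * ((h : ℝ) / (Nat.totient h : ℝ)) * x *
                  (Real.exp (-(C * Real.sqrt (V * ℓ))) + Real.exp (-c₀ * Real.sqrt (Real.log x)) +
                    V * η ^ (-(1 / 4 : ℝ)))) :
    MatomakiMerikoski2023_fixedShift := by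
  refine MatomakiMerikoski2023_fixedShift_of_core_smallShift_rpow (κ := 3 / 4) (by norm_num) (by norm_num) hc₀ ?_
  intro C hC A hA
  obtain ⟨η₁, K₁, hK₁, H₁⟩ := HMT C hC A hA
  obtain ⟨η₂, K₂, hK₂, H₂⟩ := MatomakiMerikoski2023_eq71_weak C hC
  -- Siegel's theorem at `ε = 1/200`
  obtain ⟨CS, hCS, hSiegel⟩ :=
    Literature.NumberTheory.LFunctions.Siegel.exists_one_sub_realZero_ge (ε := 1 / 200) (by norm_num)
  have hlog2 : 0 < Real.log 2 := Real.log_pos one_lt_two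
  set D : ℝ := 1 / (CS * Real.log 2) with hDdef
  have hD : 0 < D := by positivity
  refine ⟨max (max η₁ η₂) (D * (D + 1 + A)), K₁ + K₂, by positivity, ?_⟩
  intro q _ hq χ hprim hquad η hη10 hη0 hL x hx hnorm δ hδ1 hδ2 hδ3 h hh heven hhA
  have hη₁ : η₁ ≤ η := le_trans (le_trans (le_max_left _ _) (le_max_left _ _)) hη0
  have hη₂ : η₂ ≤ η := le_trans (le_trans (le_max_right _ _) (le_max_left _ _)) hη0
  have hηD : D * (D + 1 + A) ≤ η := le_trans (le_max_right _ _) hη0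
  have hη00 : 0 < η := by linarith
  -- basic sizes
  have hq3 : (3 : ℝ) ≤ q := by exact_mod_cast hq
  have hq0 : (0 : ℝ) < q := by linarith
  have hq1 : (1 : ℝ) < q := by linarith
  have hlogq : Real.log 2 ≤ Real.log q := Real.log_le_log two_pos (by linarith)
  have hlogq0 : 0 < Real.log q := by linarith
  have hqpow : 0 < (q : ℝ) ^ (37 / 4 : ℝ) := Real.rpow_pos_of_pos hq0 _
  have hx0 : 0 < x := lt_of_lt_of_le hqpow hx
  -- Siegel: `η ≤ D q^{1/200}`
  have hne : χ ≠ 1 := by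
    intro h1
    have := (DirichletCharacter.eq_one_iff_conductor_eq_one (χ := χ)).mp h1
    rw [hprim] at this
    omega
  have hηle : η ≤ D * (q : ℝ) ^ (1 / 200 : ℝ) := by
    have hS := hSiegel q χ hquad.sq_eq_one hne (1 - 1 / (η * Real.log q)) hL
    have hS' : CS * (q : ℝ) ^ (-(1 / 200 : ℝ)) ≤ 1 / (η * Real.log q) := by linarith
    have hpos : 0 < CS * (q : ℝ) ^ (-(1 / 200 : ℝ)) := by positivity
    have hηlog : η * Real.log q ≤ (q : ℝ) ^ (1 / 200 : ℝ) / CS := by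
      have := (le_one_div hpos (by positivity)).mp hS'
      calc η * Real.log q ≤ 1 / (CS * (q : ℝ) ^ (-(1 / 200 : ℝ))) := this
        _ = (q : ℝ) ^ (1 / 200 : ℝ) / CS := by rw [Real.rpow_neg hq0.le]; field_simp
    calc η = η * Real.log q / Real.log q := by field_simp
      _ ≤ ((q : ℝ) ^ (1 / 200 : ℝ) / CS) / Real.log q := by gcongr
      _ ≤ ((q : ℝ) ^ (1 / 200 : ℝ) / CS) / Real.log 2 := by gcongr
      _ = D * (q : ℝ) ^ (1 / 200 : ℝ) := by rw [hDdef]; field_simp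
  have hqε0 : 0 < (q : ℝ) ^ (1 / 200 : ℝ) := Real.rpow_pos_of_pos hq0 _
  -- normalisation 1: `log η ≤ (log q)/100` (else `q^{1/200} < D`, `η < D·D`)
  have hlogηq : Real.log η ≤ Real.log q / 100 := by
    by_cases hqD : D ≤ (q : ℝ) ^ (1 / 200 : ℝ)
    · have h1 : Real.log η ≤ Real.log D + Real.log q / 200 := by
        calc Real.log η ≤ Real.log (D * (q : ℝ) ^ (1 / 200 : ℝ)) := Real.log_le_log hη00 hηle
          _ = Real.log D + (1 / 200 : ℝ) * Real.log q := by
              rw [Real.log_mul hD.ne' hqε0.ne', Real.log_rpow hq0]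
          _ = Real.log D + Real.log q / 200 := by ring
      have h2 : Real.log D ≤ Real.log q / 200 := by
        calc Real.log D ≤ Real.log ((q : ℝ) ^ (1 / 200 : ℝ)) := Real.log_le_log hD hqD
          _ = Real.log q / 200 := by rw [Real.log_rpow hq0]; ring
      linarith
    · exfalso
      push Not at hqD
      have h1 : η < D * D := by
        calc η ≤ D * (q : ℝ) ^ (1 / 200 : ℝ) := hηle
          _ < D * D := mul_lt_mul_of_pos_left hqD hD
      have h2 : D * D ≤ D * (D + 1 + A) := mul_le_mul_of_nonneg_left (by linarith) hD.le
      linarith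
  -- normalisation 2: `A ≤ x` (else `q^{37/4} < A`, so `q^{1/200} ≤ 1 + A` and `η < D(1 + A)`)
  have hAx : A ≤ x := by
    by_contra hlt
    push Not at hlt
    have h1 : (q : ℝ) ^ (1 / 200 : ℝ) ≤ 1 + A := by
      -- `q^{1/200} ≤ q^{37/4} < A` when `q ≥ 1`
      have h2 : (q : ℝ) ^ (1 / 200 : ℝ) ≤ (q : ℝ) ^ (37 / 4 : ℝ) :=
        Real.rpow_le_rpow_of_exponent_le hq1.le (by norm_num)
      linarith
    have h3 : η < D * (1 + A) + D * D := by
      calc η ≤ D * (q : ℝ) ^ (1 / 200 : ℝ) := hηle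
        _ ≤ D * (1 + A) := mul_le_mul_of_nonneg_left h1 hD.le
        _ < D * (1 + A) + D * D := by nlinarith
    have h4 : D * (1 + A) + D * D = D * (D + 1 + A) := by ring
    linarith
  -- the parameters and the weight
  obtain ⟨V, hV⟩ : ∃ V : ℝ, V = Real.log x / Real.log q := ⟨_, rfl⟩
  obtain ⟨ℓ, hℓ⟩ : ∃ ℓ : ℝ, ℓ = Real.log η := ⟨_, rfl⟩
  obtain ⟨u, hu⟩ : ∃ u : ℝ, u = min (Real.sqrt (V * ℓ) / (10 * C)) ℓ := ⟨_, rfl⟩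
  obtain ⟨v, hv⟩ : ∃ v : ℝ, v = V / u := ⟨_, rfl⟩
  have e34 : ((3 : ℝ) / 4 - 1) = -(1 / 4 : ℝ) := by norm_num
  rw [e34] at hnorm ⊢
  have hnormV : V * η ^ (-(1 / 4 : ℝ)) ≤ 1 := by rw [hV]; exact hnorm
  rw [← hV]
  have hδ0 : 0 < δ := by
    have : 0 < x ^ (-(1 / 999 : ℝ)) / 4 := by positivity
    linarith
  have hab : 1 + δ ≤ 2 - δ := by linarith
  set g : ℝ → ℝ := plateauCutoff (1 + δ) (2 - δ) δ with hg
  have hg0 : ∀ t, 0 ≤ g t := fun t => plateauCutoff_nonneg hδ0 hab t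
  have hg1 : ∀ t, g t ≤ 1 := fun t => plateauCutoff_le_one hδ0 hab t
  have hgs : ∀ t, g t ≠ 0 → 1 ≤ t ∧ t ≤ 2 := by
    intro t ht
    by_contra hcon
    rw [not_and_or, not_le, not_le] at hcon
    rcases hcon with h1 | h1
    · exact ht (plateauCutoff_eq_zero_of_le hδ0 hab (by linarith))
    · exact ht (plateauCutoff_eq_zero_of_ge hδ0 hab (by linarith))
  have hhx : (h : ℝ) ≤ x := hhA.trans hAx
  -- the two inputs
  have h71 := H₂ q hq χ hprim hquad η hη₂ hlogηq hL x hx V ℓ u v hV hℓ hu hv hnormV g hg0 hg1 hgs h hh hhx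
  have hmt := H₁ q hq χ hprim hquad η hη10 hη₁ hlogηq hL x hx hAx hnorm V ℓ u v hV hℓ hu hv δ hδ1 hδ2 hδ3
    h hh heven hhA
  -- reassociate the summand and combine
  have hsum : ∑ n ∈ Icc 1 ⌊2 * x⌋₊, g (n / x) * (Λ n * Λ (n + h)) =
      ∑ n ∈ Icc 1 ⌊2 * x⌋₊, g (n / x) * Λ n * Λ (n + h) :=
    Finset.sum_congr rfl fun n _ => by ring
  rw [hsum]
  have hsqrt : Real.sqrt (V * Real.log η) = Real.sqrt (V * ℓ) := by rw [hℓ]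
  rw [hsqrt, show -C * Real.sqrt (V * ℓ) = -(C * Real.sqrt (V * ℓ)) by ring]
  set F : ℝ := (h : ℝ) / (Nat.totient h : ℝ) with hF
  set E₁ : ℝ := Real.exp (-(C * Real.sqrt (V * ℓ))) with hE₁
  set E₂ : ℝ := Real.exp (-c₀ * Real.sqrt (Real.log x)) with hE₂
  set E₃ : ℝ := V * η ^ (-(1 / 4 : ℝ)) with hE₃
  have hF0 : 0 ≤ F := by positivity
  have hE20 : 0 ≤ E₂ := (Real.exp_pos _).le
  have hK₂F : 0 ≤ K₂ * F * x := by positivity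
  calc _ ≤ _ + _ := abs_sub_le _ _ _
    _ ≤ K₂ * F * x * (E₁ + E₃) + K₁ * F * x * (E₁ + E₂ + E₃) := add_le_add h71 hmt
    _ ≤ K₂ * F * x * (E₁ + E₂ + E₃) + K₁ * F * x * (E₁ + E₂ + E₃) := by
        have : K₂ * F * x * (E₁ + E₃) ≤ K₂ * F * x * (E₁ + E₂ + E₃) :=
          mul_le_mul_of_nonneg_left (by linarith) hK₂F
        linarith
    _ = (K₁ + K₂) * F * x * (E₁ + E₂ + E₃) := by ring

end Literature.Barriers.Parity.MatomakiMerikoski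

end
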